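import Literature.Analysis.FluidPDE.PeriodicCylinderFlux
import Literature.Analysis.FluidPDE.SpaceTimeSliceCalculus
import HarnessLib

/-!
# Uniqueness of smooth Euler flows in the periodic cylinder:
`KatoLai1984_periodicCylinderUniqueness_holds`

Topic `Literature/Analysis/FluidPDE`. Discharge of the named fact
`Literature.Analysis.FluidPDE.KatoLai1984_periodicCylinderUniqueness` (`KatoLaiPeriodicCylinder.lean`;
Kato–Lai 1984, Thm I, p. 17, uniqueness clause, proof p. 23: "it suffices to note that
`dₜ‖u − v‖₀² = 2(u − v | dₜ(u − v))₀` for any two solutions `u, v`"; quoted with the pressure as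
Ferrari 1993, Thm 1): two solutions of the class `IsPeriodicCylinderEulerSolution L [0,T) u₀`
have the same velocity on `[0, T) × closure {r < 1}`.

## The proof (the `L²` energy method on a period cell, in cylindrical coordinates)

Everything is computed on the parameter box `B = [0,1] × [−π,π] × [0,L]` of a period cell,
`Φ(r,θ,z) = (r cos θ, r sin θ, z)` (`PeriodicCylinderFlux`), with the Jacobian weight `r`:
for `w = u₁ − u₂`, `e(s) = ∫_B r ‖w(s, Φ)‖²`.

1. `e` is continuous on `[0, T']` and differentiable on `(0, T')`, `T' < T`, with
   `e'(s) = ∫_B r · 2⟪w, ∂ₜw⟫(s, Φ)` (differentiation under the integral sign on the compact box;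
   `∂ₜw` is jointly continuous up to the boundary, `continuousOn_uncurry_timeDerivWithin`).
2. At each time, `2⟪w, ∂ₜw⟫ = −div(⟪w,w⟫u₁ + 2πw) − 2⟪w, Du₂ w⟫` in `{r < 1}`
   (`two_mul_inner_sub_timeDeriv_eq`), the field `G = ⟪w,w⟫u₁ + 2πw` is `C¹` on the closed
   cylinder, `L`-periodic (velocities **and pressures** are periodic) and tangential on the wall,
   so `∫_B r (div G)∘Φ = 0` (`setIntegral_mul_divergence_cylCoord_eq_zero`), whence
   `e' ≤ 2M e` with `M = sup |Du₂|` over `[0,T'] ×` cell (`setIntegral_energyFlux_le`).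
3. Grönwall (`exp(−2Ms) e(s)` is nonincreasing, `e(0) = 0`) gives `e ≡ 0`; the continuous
   nonnegative integrand vanishes on `B`, i.e. `w(t, Φ p) = 0` for `p ∈ B`, `p₀ > 0`; points of
   the axis follow by continuity and other heights `z` by periodicity
   (`eqOn_zero_closure_of_cylCoord`).

No change of variables between the cell and the box is used. Mathlib: differentiation under
the integral sign (`hasDerivAt_integral_of_dominated_loc_of_deriv_le`), `continuousOn_of_dominated`,
`antitoneOn_of_deriv_nonpos`, `Measure.eqOn_of_ae_eq`, `Complex.cos_arg`/`sin_arg` (polar angle).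
-/

noncomputable section

open MeasureTheory Set Function Filter Topology TopologicalSpace WithLp
open scoped ContDiff NNReal ENNReal InnerProductSpace RealInnerProductSpace

namespace Literature.Analysis.FluidPDE

/-! ### Geometry of the closed cylinder and the parameter box -/

/-- The closed cylinder is a set of unique differentiability (convex with nonempty
interior). [folklore] -/
theorem uniqueDiffOn_closure_unitCylinder : UniqueDiffOn ℝ (closure (unitCylinder : Set (EuclideanSpace ℝ (Fin 3)))) :=
  uniqueDiffOn_convex convex_unitCylinder.closure
    ⟨0, interior_mono subset_closure (by
      rw [unitCylinder.isOpen.interior_eq]; exact zero_mem_unitCylinder)⟩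

/-- The closed cylinder is a neighbourhood of each point of the open cylinder. [folklore] -/
theorem closure_unitCylinder_mem_nhds {x : (EuclideanSpace ℝ (Fin 3))} (hx : x ∈ unitCylinder) :
    closure (unitCylinder : Set (EuclideanSpace ℝ (Fin 3))) ∈ 𝓝 x :=
  mem_of_superset (unitCylinder.isOpen.mem_nhds hx) subset_closure

/-- **Cylindrical coordinates cover the closed cylinder off the axis**: a point with
`0 < r ≤ 1` and `0 ≤ z ≤ L` is `Φ p` for a parameter `p` of the closed box with `p₀ = r > 0`
(`θ = arg (x₀ + i x₁) ∈ (−π, π]`). [folklore] -/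
theorem exists_cylCoord_eq {L : ℝ} {x : (EuclideanSpace ℝ (Fin 3))} (hx : x ∈ closure (unitCylinder : Set (EuclideanSpace ℝ (Fin 3))))
    (hr : 0 < cylRadius x) (hz : x 2 ∈ Icc 0 L) :
    ∃ p ∈ cylBox L, 0 < p 0 ∧ cylCoord p = x := by
  set zc : ℂ := ⟨x 0, x 1⟩ with hzc
  have hnorm : ‖zc‖ = cylRadius x := by
    rw [Complex.norm_def, Complex.normSq_apply, cylRadius]
    congr 1
    simp only [hzc]
    ring
  have hzc0 : zc ≠ 0 := by
    intro h
    rw [h, norm_zero] at hnorm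
    exact hr.ne' hnorm.symm
  have hr1 : cylRadius x ≤ 1 := by
    rw [closure_unitCylinder] at hx
    exact hx
  have hπ := Complex.neg_pi_lt_arg zc
  have hπ' := Complex.arg_le_pi zc
  refine ⟨![cylRadius x, Complex.arg zc, x 2], ⟨fun i => ?_, fun i => ?_⟩, by simpa using hr, ?_⟩
  · fin_cases i <;> simp [cylBoxLo, cylRadius_nonneg, hπ.le, hz.1]
  · fin_cases i <;> simp [cylBoxHi, hr1, hπ', hz.2]
  · have hc : cylRadius x * Real.cos (Complex.arg zc) = x 0 := by
      rw [Complex.cos_arg hzc0, hnorm]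
      field_simp
      simp [hzc]
    have hs : cylRadius x * Real.sin (Complex.arg zc) = x 1 := by
      rw [Complex.sin_arg, hnorm]
      field_simp
      simp [hzc]
    ext i
    fin_cases i
    · simpa using hc
    · simpa using hs
    · simp

/-- Iterating axial periodicity: `v (x + kL e_z) = v x` for every integer `k`. [folklore] -/
theorem IsAxiallyPeriodic.add_int_mul {F : Sort*} {L : ℝ} {v : (EuclideanSpace ℝ (Fin 3)) → F} (hv : IsAxiallyPeriodic L v)
    (k : ℤ) (x : (EuclideanSpace ℝ (Fin 3))) : v (x + ((k : ℝ) * L) • EuclideanSpace.single (2 : Fin 3) (1 : ℝ)) = v x := by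
  induction k using Int.induction_on generalizing x with
  | zero => simp
  | succ i ih =>
    have e : x + (((i : ℤ) + 1 : ℤ) * L : ℝ) • EuclideanSpace.single (2 : Fin 3) (1 : ℝ) =
        (x + ((i : ℤ) * L : ℝ) • EuclideanSpace.single (2 : Fin 3) (1 : ℝ)) +
          L • EuclideanSpace.single (2 : Fin 3) (1 : ℝ) := by
      push_cast
      rw [add_mul, one_mul, add_smul, add_assoc]
    rw [e, hv, ih]
  | pred i ih =>
    have e : x + ((-(i : ℤ) : ℤ) * L : ℝ) • EuclideanSpace.single (2 : Fin 3) (1 : ℝ) =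
        (x + ((-(i : ℤ) - 1 : ℤ) * L : ℝ) • EuclideanSpace.single (2 : Fin 3) (1 : ℝ)) +
          L • EuclideanSpace.single (2 : Fin 3) (1 : ℝ) := by
      push_cast
      rw [add_assoc, ← add_smul]
      congr 2
      ring
    rw [← ih x, e, hv]

/-- **A continuous periodic field vanishing on the image of the box vanishes on the closed
cylinder.** If `v` is continuous on `{r ≤ 1}`, `L`-periodic (`L > 0`) and `v(Φ p) = 0` for all
parameters `p ∈ [0,1]×[−π,π]×[0,L]` with `p₀ > 0`, then `v = 0` on `{r ≤ 1}`: off the axis and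
for `0 ≤ z ≤ L` this is `exists_cylCoord_eq`; on the axis, `v(y) = lim_{c ↓ 0} v(y + c e₀) = 0`;
other heights reduce to `[0, L)` by periodicity (`z ↦ z − ⌊z/L⌋L`). [folklore] -/
theorem eqOn_zero_closure_of_cylCoord {F : Type*} [NormedAddCommGroup F] {v : (EuclideanSpace ℝ (Fin 3)) → F} {L : ℝ}
    (hL : 0 < L) (hv : ContinuousOn v (closure (unitCylinder : Set (EuclideanSpace ℝ (Fin 3))))) (hper : IsAxiallyPeriodic L v)
    (h0 : ∀ p ∈ cylBox L, 0 < p 0 → v (cylCoord p) = 0) :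
    ∀ y ∈ closure (unitCylinder : Set (EuclideanSpace ℝ (Fin 3))), v y = 0 := by
  -- points of height `z ∈ [0, L]`
  have key : ∀ y ∈ closure (unitCylinder : Set (EuclideanSpace ℝ (Fin 3))), y 2 ∈ Icc 0 L → v y = 0 := by
    intro y hy hz
    by_cases hr : 0 < cylRadius y
    · obtain ⟨p, hp, hp0, rfl⟩ := exists_cylCoord_eq hy hr hz
      exact h0 p hp hp0
    · -- a point of the axis: approach it along `c ↦ y + c e₀`
      have hr0 : cylRadius y = 0 := le_antisymm (not_lt.1 hr) (cylRadius_nonneg y)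
      obtain ⟨hy0, hy1⟩ := (cylRadius_eq_zero_iff y).1 hr0
      set e₀ : (EuclideanSpace ℝ (Fin 3)) := EuclideanSpace.single (0 : Fin 3) (1 : ℝ) with he₀
      set g : ℝ → F := fun c => v (y + c • e₀) with hg
      have hrad : ∀ c : ℝ, 0 ≤ c → cylRadius (y + c • e₀) = c := fun c hc => by
        rw [cylRadius]
        have h2 : (y + c • e₀) 0 ^ 2 + (y + c • e₀) 1 ^ 2 = c ^ 2 := by
          simp [he₀, hy0, hy1]
        rw [h2, Real.sqrt_sq hc]
      have hmemK : ∀ c ∈ Icc (0 : ℝ) 1, y + c • e₀ ∈ closure (unitCylinder : Set (EuclideanSpace ℝ (Fin 3))) :=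
        fun c hc => by
        rw [closure_unitCylinder, mem_setOf_eq, hrad c hc.1]
        exact hc.2
      have hz' : ∀ c : ℝ, (y + c • e₀) 2 = y 2 := fun c => by simp [he₀]
      have hzero : ∀ c ∈ Ioc (0 : ℝ) 1, g c = 0 := fun c hc => by
        obtain ⟨p, hp, hp0, hpe⟩ := exists_cylCoord_eq (L := L) (hmemK c ⟨hc.1.le, hc.2⟩)
          (by rw [hrad c hc.1.le]; exact hc.1) (by rw [hz']; exact hz)
        rw [hg]
        simp only [← hpe]
        exact h0 p hp hp0
      have hcont : ContinuousWithinAt g (Ioc 0 1) 0 := by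
        have hc : ContinuousOn g (Icc 0 1) :=
          hv.comp ((continuous_const.add (continuous_id.smul continuous_const)).continuousOn) hmemK
        exact (hc 0 ⟨le_rfl, zero_le_one⟩).mono Ioc_subset_Icc_self
      have hlim : Tendsto g (𝓝[Ioc (0 : ℝ) 1] 0) (𝓝 0) :=
        tendsto_const_nhds.congr' (eventually_nhdsWithin_of_forall fun c hc => (hzero c hc).symm)
      haveI : (𝓝[Ioc (0 : ℝ) 1] 0).NeBot := left_nhdsWithin_Ioc_neBot zero_lt_one
      have h00 : g 0 = 0 := tendsto_nhds_unique hcont hlim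
      simpa [hg] using h00
  -- general height: shift by `−⌊z/L⌋ L`
  intro y hy
  set k : ℤ := ⌊y 2 / L⌋ with hk
  set y' : (EuclideanSpace ℝ (Fin 3)) := y + (((-k : ℤ) : ℝ) * L) • EuclideanSpace.single (2 : Fin 3) (1 : ℝ) with hy'
  have hy'K : y' ∈ closure (unitCylinder : Set (EuclideanSpace ℝ (Fin 3))) := by
    rw [closure_unitCylinder, mem_setOf_eq] at hy ⊢
    rwa [hy', cylRadius_add_axialShift]
  have hz : y' 2 ∈ Icc 0 L := by
    have h2 : y' 2 = y 2 - ⌊y 2 / L⌋ * L := by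
      simp [hy', hk]
      ring
    rw [h2]
    exact ⟨Int.sub_floor_div_mul_nonneg _ hL, (Int.sub_floor_div_mul_lt _ hL).le⟩
  have := key y' hy'K hz
  rwa [hy', hper.add_int_mul] at this

/-! ### The fixed-time energy inequality on the box -/

/-- **The basic energy inequality at a fixed time, on the parameter box of a period cell**
(Kato–Lai 1984 p. 23; Majda–Bertozzi (3.5) in a bounded domain): for two velocity/pressure
pairs `(a, P₁)`, `(b, P₂)`, `C¹` on the closed cylinder, `L`-periodic, tangential on the wall,
divergence free and satisfying the momentum equations `a' + (a·∇)a = −∇P₁`,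
`b' + (b·∇)b = −∇P₂` in `{r < 1}` with continuous `a', b'`, and `|Db| ≤ M` on the image of the
open box (no sign condition on `M` is needed),
`∫_B r · 2⟪a − b, a' − b'⟫∘Φ ≤ 2M ∫_B r ‖a − b‖²∘Φ`.
Proof: on the open box the integrand is `−r (div G)∘Φ − r · 2⟪w, Db w⟫∘Φ` with
`G = ⟪w,w⟫a + 2(P₁ − P₂)w` (`two_mul_inner_sub_timeDeriv_eq`), `∫_B r (div G)∘Φ = 0`
(`setIntegral_mul_divergence_cylCoord_eq_zero`: `G` is `C¹` on the closed cylinder, periodic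
and tangential), and `−2⟪w, Db w⟫ ≤ 2M‖w‖²`. [folklore] -/
theorem setIntegral_energyFlux_le {L M : ℝ} (hL : 0 ≤ L) {a b a' b' : (EuclideanSpace ℝ (Fin 3)) → (EuclideanSpace ℝ (Fin 3))} {P₁ P₂ : (EuclideanSpace ℝ (Fin 3)) → ℝ}
    (ha : ContDiffOn ℝ 1 a (closure (unitCylinder : Set (EuclideanSpace ℝ (Fin 3)))))
    (hb : ContDiffOn ℝ 1 b (closure (unitCylinder : Set (EuclideanSpace ℝ (Fin 3)))))
    (hP₁ : ContDiffOn ℝ 1 P₁ (closure (unitCylinder : Set (EuclideanSpace ℝ (Fin 3)))))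
    (hP₂ : ContDiffOn ℝ 1 P₂ (closure (unitCylinder : Set (EuclideanSpace ℝ (Fin 3)))))
    (ha' : ContinuousOn a' (closure (unitCylinder : Set (EuclideanSpace ℝ (Fin 3)))))
    (hb' : ContinuousOn b' (closure (unitCylinder : Set (EuclideanSpace ℝ (Fin 3)))))
    (hma : ∀ x ∈ unitCylinder, a' x + convect a a x = -gradient P₁ x)
    (hmb : ∀ x ∈ unitCylinder, b' x + convect b b x = -gradient P₂ x)
    (hdiva : ∀ x ∈ unitCylinder, VectorCalculus.divergence a x = 0)
    (hdivb : ∀ x ∈ unitCylinder, VectorCalculus.divergence b x = 0)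
    (hslipa : ∀ x ∈ frontier (unitCylinder : Set (EuclideanSpace ℝ (Fin 3))), ⟪a x, eR x⟫ = 0)
    (hslipb : ∀ x ∈ frontier (unitCylinder : Set (EuclideanSpace ℝ (Fin 3))), ⟪b x, eR x⟫ = 0)
    (hpa : IsAxiallyPeriodic L a) (hpb : IsAxiallyPeriodic L b) (hpP₁ : IsAxiallyPeriodic L P₁)
    (hpP₂ : IsAxiallyPeriodic L P₂)
    (hM : ∀ p ∈ cylBoxOpen L, ‖fderiv ℝ b (cylCoord p)‖ ≤ M) :
    ∫ p in cylBox L, p 0 * (2 * ⟪a (cylCoord p) - b (cylCoord p), a' (cylCoord p) - b' (cylCoord p)⟫) ≤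
      2 * M * ∫ p in cylBox L, p 0 * ‖a (cylCoord p) - b (cylCoord p)‖ ^ 2 := by
  set K : Set (EuclideanSpace ℝ (Fin 3)) := closure (unitCylinder : Set (EuclideanSpace ℝ (Fin 3))) with hK
  have hKu : UniqueDiffOn ℝ K := uniqueDiffOn_closure_unitCylinder
  -- the field `G = ⟪w,w⟫ a + 2π w`
  set G : (EuclideanSpace ℝ (Fin 3)) → (EuclideanSpace ℝ (Fin 3)) := fun y => ⟪a y - b y, a y - b y⟫ • a y + (2 * (P₁ y - P₂ y)) • (a y - b y)
    with hG
  have hw : ContDiffOn ℝ 1 (fun y => a y - b y) K := ha.sub hb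
  have hGc : ContDiffOn ℝ 1 G K :=
    ((hw.inner ℝ hw).smul ha).add ((contDiffOn_const.mul (hP₁.sub hP₂)).smul hw)
  have hGper : IsAxiallyPeriodic L G := fun y => by
    simp only [hG, hpa y, hpb y, hpP₁ y, hpP₂ y]
  have hGslip : ∀ x ∈ frontier (unitCylinder : Set (EuclideanSpace ℝ (Fin 3))), ⟪G x, eR x⟫ = 0 := fun x hx => by
    simp only [hG, inner_add_left, inner_smul_left, inner_sub_left, hslipa x hx, hslipb x hx,
      sub_zero, mul_zero, RCLike.conj_to_real, add_zero]
  have hflux : ∫ p in cylBox L, p 0 * VectorCalculus.divergence G (cylCoord p) = 0 :=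
    setIntegral_mul_divergence_cylCoord_eq_zero hL hGc hGper hGslip
  -- continuity of the composed fields on the closed box
  have hmaps : MapsTo cylCoord (cylBox L) K := fun p hp => cylCoord_mem_closure_of_mem_cylBox hp
  have cΦ : ContinuousOn cylCoord (cylBox L) := continuous_cylCoord.continuousOn
  have ca : ContinuousOn (fun p => a (cylCoord p)) (cylBox L) := ha.continuousOn.comp cΦ hmaps
  have cb : ContinuousOn (fun p => b (cylCoord p)) (cylBox L) := hb.continuousOn.comp cΦ hmaps
  have ca' : ContinuousOn (fun p => a' (cylCoord p)) (cylBox L) := ha'.comp cΦ hmaps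
  have cb' : ContinuousOn (fun p => b' (cylCoord p)) (cylBox L) := hb'.comp cΦ hmaps
  have cDb : ContinuousOn (fun p => fderivWithin ℝ b K (cylCoord p)) (cylBox L) :=
    (hb.continuousOn_fderivWithin hKu le_rfl).comp cΦ hmaps
  have c0 : ContinuousOn (fun p : Fin 3 → ℝ => p 0) (cylBox L) := (continuous_apply 0).continuousOn
  -- the three integrands
  set F : (Fin 3 → ℝ) → ℝ := fun p =>
    p 0 * (2 * ⟪a (cylCoord p) - b (cylCoord p), a' (cylCoord p) - b' (cylCoord p)⟫) with hF
  set R : (Fin 3 → ℝ) → ℝ := fun p =>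
    p 0 * (2 * ⟪a (cylCoord p) - b (cylCoord p),
      fderivWithin ℝ b K (cylCoord p) (a (cylCoord p) - b (cylCoord p))⟫) with hR
  set Q : (Fin 3 → ℝ) → ℝ := fun p => p 0 * ‖a (cylCoord p) - b (cylCoord p)‖ ^ 2 with hQ
  set D : (Fin 3 → ℝ) → ℝ := fun p => p 0 * VectorCalculus.divergence G (cylCoord p) with hD
  have cF : ContinuousOn F (cylBox L) := c0.mul (continuousOn_const.mul ((ca.sub cb).inner (ca'.sub cb')))
  have cR : ContinuousOn R (cylBox L) :=
    c0.mul (continuousOn_const.mul ((ca.sub cb).inner (cDb.clm_apply (ca.sub cb))))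
  have cQ : ContinuousOn Q (cylBox L) := c0.mul ((ca.sub cb).norm.pow 2)
  have iF : IntegrableOn F (cylBox L) := cF.integrableOn_compact isCompact_Icc
  have iR : IntegrableOn R (cylBox L) := cR.integrableOn_compact isCompact_Icc
  have iQ : IntegrableOn Q (cylBox L) := cQ.integrableOn_compact isCompact_Icc
  -- pointwise identity on the open box
  have hpt : ∀ p ∈ cylBoxOpen L, F p = -D p - R p := by
    intro p hp
    have hx : cylCoord p ∈ unitCylinder := cylCoord_mem_of_mem_cylBoxOpen hp
    have hKx : K ∈ 𝓝 (cylCoord p) := closure_unitCylinder_mem_nhds hx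
    have hxK : cylCoord p ∈ K := subset_closure hx
    have da : DifferentiableAt ℝ a (cylCoord p) :=
      (ha.differentiableOn one_ne_zero _ hxK).differentiableAt hKx
    have db : DifferentiableAt ℝ b (cylCoord p) :=
      (hb.differentiableOn one_ne_zero _ hxK).differentiableAt hKx
    have dP₁ : DifferentiableAt ℝ P₁ (cylCoord p) :=
      (hP₁.differentiableOn one_ne_zero _ hxK).differentiableAt hKx
    have dP₂ : DifferentiableAt ℝ P₂ (cylCoord p) :=
      (hP₂.differentiableOn one_ne_zero _ hxK).differentiableAt hKx
    have ea : a' (cylCoord p) = -gradient P₁ (cylCoord p) - fderiv ℝ a (cylCoord p) (a (cylCoord p)) := by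
      rw [← hma _ hx, convect_apply]; abel
    have eb : b' (cylCoord p) = -gradient P₂ (cylCoord p) - fderiv ℝ b (cylCoord p) (b (cylCoord p)) := by
      rw [← hmb _ hx, convect_apply]; abel
    have key := two_mul_inner_sub_timeDeriv_eq da db dP₁ dP₂ ea eb (hdiva _ hx) (hdivb _ hx)
    have hfw : fderivWithin ℝ b K (cylCoord p) = fderiv ℝ b (cylCoord p) := fderivWithin_of_mem_nhds hKx
    simp only [hF, hD, hR, hG, key, hfw]
    ring
  have haeF : F =ᵐ[volume.restrict (cylBox L)] fun p => -D p - R p :=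
    ae_restrict_cylBox_of_forall hpt
  have iD : IntegrableOn D (cylBox L) := by
    have h1 : IntegrableOn (fun p => -F p - R p) (cylBox L) := iF.neg.sub iR
    refine h1.congr_fun_ae (ae_restrict_cylBox_of_forall fun p hp => ?_)
    simp only [hpt p hp]
    ring
  -- the bound on `-R`
  have hRle : ∀ p ∈ cylBoxOpen L, -R p ≤ 2 * M * Q p := by
    intro p hp
    have hx : cylCoord p ∈ unitCylinder := cylCoord_mem_of_mem_cylBoxOpen hp
    have hp0 : 0 ≤ p 0 := (radius_mem_of_mem_cylBoxOpen hp).1.le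
    have hfw : fderivWithin ℝ b K (cylCoord p) = fderiv ℝ b (cylCoord p) :=
      fderivWithin_of_mem_nhds (closure_unitCylinder_mem_nhds hx)
    set wv := a (cylCoord p) - b (cylCoord p) with hwv
    have hin : |⟪wv, fderiv ℝ b (cylCoord p) wv⟫| ≤ M * ‖wv‖ ^ 2 :=
      calc |⟪wv, fderiv ℝ b (cylCoord p) wv⟫| ≤ ‖wv‖ * ‖fderiv ℝ b (cylCoord p) wv‖ :=
            abs_real_inner_le_norm _ _
        _ ≤ ‖wv‖ * (M * ‖wv‖) := by
            gcongr
            exact (ContinuousLinearMap.le_opNorm _ _).trans (by gcongr; exact hM p hp)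
        _ = M * ‖wv‖ ^ 2 := by ring
    have hneg : -⟪wv, fderiv ℝ b (cylCoord p) wv⟫ ≤ M * ‖wv‖ ^ 2 := (neg_le_abs _).trans hin
    simp only [hR, hQ, hfw, ← hwv]
    nlinarith
  have hint_le : ∫ p in cylBox L, -R p ≤ ∫ p in cylBox L, 2 * M * Q p :=
    integral_mono_ae iR.neg (iQ.const_mul (2 * M)) (ae_restrict_cylBox_of_forall hRle)
  -- assemble
  calc ∫ p in cylBox L, F p = ∫ p in cylBox L, (-D p - R p) := integral_congr_ae haeF
    _ = -(∫ p in cylBox L, D p) - ∫ p in cylBox L, R p := by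
        have iDn : IntegrableOn (fun p => -D p) (cylBox L) := iD.neg
        rw [integral_sub iDn iR, integral_neg]
    _ = ∫ p in cylBox L, -R p := by rw [hflux, neg_zero, zero_sub, integral_neg]
    _ ≤ ∫ p in cylBox L, 2 * M * Q p := hint_le
    _ = 2 * M * ∫ p in cylBox L, Q p := integral_const_mul _ _

/-! ### The discharge -/

/-- The closed parameter box lies in the closure of its interior (all sides are
nondegenerate for `L > 0`). [folklore] -/
theorem cylBox_subset_closure_interior {L : ℝ} (hL : 0 < L) :
    cylBox L ⊆ closure (interior (cylBox L)) := by
  have hlt : ∀ i, cylBoxLo i < cylBoxHi L i := fun i => by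
    fin_cases i
    · simp
    · show -Real.pi < Real.pi; linarith [Real.pi_pos]
    · simpa using hL
  have h1 : cylBoxOpen L ⊆ interior (cylBox L) :=
    interior_maximal (fun p hp => ⟨fun i => (hp i (mem_univ _)).1.le, fun i => (hp i (mem_univ _)).2.le⟩)
      (isOpen_set_pi finite_univ fun i _ => isOpen_Ioo)
  have h2 : closure (cylBoxOpen L) = cylBox L := by
    rw [closure_pi_set]
    show (univ.pi fun i => closure (Ioo (cylBoxLo i) (cylBoxHi L i))) = Icc cylBoxLo (cylBoxHi L)
    rw [← Set.pi_univ_Icc]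
    exact pi_congr rfl fun i _ => closure_Ioo (hlt i).ne
  calc cylBox L = closure (cylBoxOpen L) := h2.symm
    _ ⊆ closure (interior (cylBox L)) := closure_mono h1

/-- Points of the open box lie in the closed box. [folklore] -/
theorem mem_cylBox_of_mem_cylBoxOpen {L : ℝ} {p : Fin 3 → ℝ} (hp : p ∈ cylBoxOpen L) : p ∈ cylBox L :=
  ⟨fun i => (hp i (mem_univ _)).1.le, fun i => (hp i (mem_univ _)).2.le⟩

/-- **Discharge of `KatoLai1984_periodicCylinderUniqueness`** (Kato–Lai 1984, Thm I, p. 17,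
uniqueness clause; proof p. 23: `dₜ‖u − v‖₀² = 2(u − v | dₜ(u − v))₀`; Ferrari 1993, Thm 1):
two solutions `(u₁, p₁)`, `(u₂, p₂)` of the class `IsPeriodicCylinderEulerSolution L [0,T) u₀`
(`L > 0`) have `u₁ = u₂` on `[0, T) × closure {r < 1}`. The `L²` energy of `u₁ − u₂` over a
period cell, written on the cylindrical parameter box with the weight `r`, is continuous on
`[0, T']` (`T' < T`), vanishes at `0`, and has derivative `≤ 2 sup|Du₂| ·` energy on `(0, T')`
(`setIntegral_energyFlux_le`: the transport and pressure terms are a divergence whose integral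
vanishes by the slip condition and periodicity), hence vanishes identically (Grönwall); the
continuous integrand then vanishes on the box, and `u₁(t) = u₂(t)` on the closed cylinder by
`eqOn_zero_closure_of_cylCoord`. [cite: KatoLai1984, Thm I (p. 17, uniqueness clause; proof p. 23)] -/
theorem KatoLai1984_periodicCylinderUniqueness_holds : KatoLai1984_periodicCylinderUniqueness := by
  intro L hL T u₀ u₁ u₂ p₁ p₂ h₁ h₂ t ht x hx
  -- notation and basic facts
  set S : Set ℝ := Ico 0 T with hS_def
  set K : Set (EuclideanSpace ℝ (Fin 3)) := closure (unitCylinder : Set (EuclideanSpace ℝ (Fin 3))) with hK_def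
  have hS : UniqueDiffOn ℝ S := uniqueDiffOn_Ico 0 T
  have hKu : UniqueDiffOn ℝ K := uniqueDiffOn_closure_unitCylinder
  set T' : ℝ := (t + T) / 2 with hT'_def
  have htT' : t < T' := by rw [hT'_def]; linarith [ht.2]
  have hT'T : T' < T := by rw [hT'_def]; linarith [ht.2]
  have hT'0 : 0 < T' := ht.1.trans_lt htT'
  have hIccS : Icc 0 T' ⊆ S := fun s hs => ⟨hs.1, hs.2.trans_lt hT'T⟩
  have hIooS : Ioo 0 T' ⊆ S := fun s hs => ⟨hs.1.le, hs.2.trans hT'T⟩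
  have hSnhds : ∀ s ∈ Ioo 0 T', S ∈ 𝓝 s := fun s hs =>
    mem_of_superset (Ioo_mem_nhds hs.1 (hs.2.trans hT'T)) Ioo_subset_Ico_self
  -- smoothness (`C¹` suffices)
  have hu₁ : ContDiffOn ℝ 1 (uncurry u₁) (S ×ˢ K) := h₁.smooth_velocity.of_le (by exact_mod_cast le_top)
  have hu₂ : ContDiffOn ℝ 1 (uncurry u₂) (S ×ˢ K) := h₂.smooth_velocity.of_le (by exact_mod_cast le_top)
  have hq₁ : ContDiffOn ℝ 1 (uncurry p₁) (S ×ˢ K) := h₁.smooth_pressure.of_le (by exact_mod_cast le_top)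
  have hq₂ : ContDiffOn ℝ 1 (uncurry p₂) (S ×ˢ K) := h₂.smooth_pressure.of_le (by exact_mod_cast le_top)
  have cu₁ : ContinuousOn (uncurry u₁) (S ×ˢ K) := hu₁.continuousOn
  have cu₂ : ContinuousOn (uncurry u₂) (S ×ˢ K) := hu₂.continuousOn
  have cu₁' : ContinuousOn (uncurry (timeDerivWithin S u₁)) (S ×ˢ K) :=
    continuousOn_uncurry_timeDerivWithin hu₁ le_rfl hS hKu
  have cu₂' : ContinuousOn (uncurry (timeDerivWithin S u₂)) (S ×ˢ K) :=
    continuousOn_uncurry_timeDerivWithin hu₂ le_rfl hS hKu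
  have cD₂ : ContinuousOn (fun z : ℝ × (EuclideanSpace ℝ (Fin 3)) => fderivWithin ℝ (uncurry u₂) (S ×ˢ K) z) (S ×ˢ K) :=
    hu₂.continuousOn_fderivWithin (hS.prod hKu) le_rfl
  -- the difference, its time derivative, the energy and the energy production on the box
  set w : ℝ → (EuclideanSpace ℝ (Fin 3)) → (EuclideanSpace ℝ (Fin 3)) := fun s y => u₁ s y - u₂ s y with hw
  set w' : ℝ → (EuclideanSpace ℝ (Fin 3)) → (EuclideanSpace ℝ (Fin 3)) := fun s y => timeDerivWithin S u₁ s y - timeDerivWithin S u₂ s y with hw'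
  set e : ℝ → ℝ := fun s => ∫ p in cylBox L, p 0 * ‖w s (cylCoord p)‖ ^ 2 with he
  set φ : ℝ → ℝ := fun s => ∫ p in cylBox L, p 0 * (2 * ⟪w s (cylCoord p), w' s (cylCoord p)⟫)
    with hφ
  -- `(s, p) ↦ (s, Φ p)` maps `[0, T'] × box` into `S × K`
  set Ψ : ℝ × (Fin 3 → ℝ) → ℝ × (EuclideanSpace ℝ (Fin 3)) := fun z => (z.1, cylCoord z.2) with hΨ
  have cΨ : Continuous Ψ := continuous_fst.prodMk (continuous_cylCoord.comp continuous_snd)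
  have hΨmaps : MapsTo Ψ (Icc 0 T' ×ˢ cylBox L) (S ×ˢ K) := fun z hz =>
    ⟨hIccS hz.1, cylCoord_mem_closure_of_mem_cylBox hz.2⟩
  have hQc : IsCompact (Icc (0 : ℝ) T' ×ˢ cylBox L) := isCompact_Icc.prod isCompact_Icc
  have cW : ContinuousOn (fun z : ℝ × (Fin 3 → ℝ) => w z.1 (cylCoord z.2)) (Icc 0 T' ×ˢ cylBox L) :=
    (cu₁.comp cΨ.continuousOn hΨmaps).sub (cu₂.comp cΨ.continuousOn hΨmaps)
  have cW' : ContinuousOn (fun z : ℝ × (Fin 3 → ℝ) => w' z.1 (cylCoord z.2)) (Icc 0 T' ×ˢ cylBox L) :=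
    (cu₁'.comp cΨ.continuousOn hΨmaps).sub (cu₂'.comp cΨ.continuousOn hΨmaps)
  have c0 : Continuous fun z : ℝ × (Fin 3 → ℝ) => z.2 0 := (continuous_apply 0).comp continuous_snd
  have cF : ContinuousOn (fun z : ℝ × (Fin 3 → ℝ) => z.2 0 * ‖w z.1 (cylCoord z.2)‖ ^ 2)
      (Icc 0 T' ×ˢ cylBox L) := c0.continuousOn.mul (cW.norm.pow 2)
  have cF' : ContinuousOn
      (fun z : ℝ × (Fin 3 → ℝ) => z.2 0 * (2 * ⟪w z.1 (cylCoord z.2), w' z.1 (cylCoord z.2)⟫))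
      (Icc 0 T' ×ˢ cylBox L) := c0.continuousOn.mul (continuousOn_const.mul (cW.inner cW'))
  have cDz : ContinuousOn (fun z : ℝ × (Fin 3 → ℝ) => fderivWithin ℝ (uncurry u₂) (S ×ˢ K) (Ψ z))
      (Icc 0 T' ×ˢ cylBox L) := cD₂.comp cΨ.continuousOn hΨmaps
  -- uniform bounds by compactness
  obtain ⟨C₀, hC₀⟩ := hQc.exists_bound_of_continuousOn cF
  obtain ⟨C₁, hC₁⟩ := hQc.exists_bound_of_continuousOn cF'
  obtain ⟨M, hMb⟩ := hQc.exists_bound_of_continuousOn cDz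
  -- slices at fixed time / fixed parameter
  have cFs : ∀ s ∈ Icc (0 : ℝ) T', ContinuousOn (fun p => p 0 * ‖w s (cylCoord p)‖ ^ 2) (cylBox L) :=
    fun s hs => cF.comp (continuous_const.prodMk continuous_id).continuousOn fun p hp => ⟨hs, hp⟩
  have cF's : ∀ s ∈ Icc (0 : ℝ) T',
      ContinuousOn (fun p => p 0 * (2 * ⟪w s (cylCoord p), w' s (cylCoord p)⟫)) (cylBox L) :=
    fun s hs => cF'.comp (continuous_const.prodMk continuous_id).continuousOn fun p hp => ⟨hs, hp⟩
  have cFp : ∀ p ∈ cylBox L, ContinuousOn (fun s => p 0 * ‖w s (cylCoord p)‖ ^ 2) (Icc 0 T') :=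
    fun p hp => cF.comp (continuous_id.prodMk continuous_const).continuousOn fun s hs => ⟨hs, hp⟩
  -- measure facts on the box
  have hBmeas : MeasurableSet (cylBox L) := measurableSet_Icc
  have hBfin : volume (cylBox L) ≠ ⊤ := isCompact_Icc.measure_lt_top.ne
  have hmemB : ∀ᵐ p ∂(volume.restrict (cylBox L)), p ∈ cylBox L := ae_restrict_mem hBmeas
  -- (B1) the energy is continuous on `[0, T']`
  have hB1 : ContinuousOn e (Icc 0 T') := by
    refine continuousOn_of_dominated (μ := volume.restrict (cylBox L)) (bound := fun _ => C₀)
      (fun s hs => (cFs s hs).aestronglyMeasurable hBmeas)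
      (fun s hs => hmemB.mono fun p hp => hC₀ (s, p) ⟨hs, hp⟩) (integrableOn_const hBfin)
      (hmemB.mono fun p hp => cFp p hp)
  -- (B2) the energy is differentiable on `(0, T')` with derivative `φ`
  have hB2 : ∀ s ∈ Ioo 0 T', HasDerivAt e (φ s) s := by
    intro s hs
    have hsI : s ∈ Icc 0 T' := Ioo_subset_Icc_self hs
    have hIoo : Ioo 0 T' ∈ 𝓝 s := Ioo_mem_nhds hs.1 hs.2
    have key := hasDerivAt_integral_of_dominated_loc_of_deriv_le (μ := volume.restrict (cylBox L))
      (F := fun σ p => p 0 * ‖w σ (cylCoord p)‖ ^ 2)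
      (F' := fun σ p => p 0 * (2 * ⟪w σ (cylCoord p), w' σ (cylCoord p)⟫)) (x₀ := s)
      (bound := fun _ => C₁) hIoo ?_ ((cFs s hsI).integrableOn_compact isCompact_Icc)
      ((cF's s hsI).aestronglyMeasurable hBmeas) ?_ (integrableOn_const hBfin) ?_
    · exact key.2
    · filter_upwards [hIoo] with σ hσ
      exact (cFs σ (Ioo_subset_Icc_self hσ)).aestronglyMeasurable hBmeas
    · exact hmemB.mono fun p hp σ hσ => hC₁ (σ, p) ⟨Ioo_subset_Icc_self hσ, hp⟩
    · refine hmemB.mono fun p hp σ hσ => ?_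
      have hσS : σ ∈ S := hIooS hσ
      have hxK : cylCoord p ∈ K := cylCoord_mem_closure_of_mem_cylBox hp
      have h1 : HasDerivAt (fun τ => u₁ τ (cylCoord p)) (timeDerivWithin S u₁ σ (cylCoord p)) σ :=
        hasDerivAt_time_of_contDiffOn hu₁ one_ne_zero hS hσS (hSnhds σ hσ) hxK
      have h2 : HasDerivAt (fun τ => u₂ τ (cylCoord p)) (timeDerivWithin S u₂ σ (cylCoord p)) σ :=
        hasDerivAt_time_of_contDiffOn hu₂ one_ne_zero hS hσS (hSnhds σ hσ) hxK
      exact ((h1.sub h2).norm_sq).const_mul (p 0)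
  -- (B3) the energy inequality `φ ≤ 2 M e` on `[0, T']`
  have hB3 : ∀ s ∈ Icc (0 : ℝ) T', φ s ≤ 2 * M * e s := by
    intro s hs
    have hsS : s ∈ S := hIccS hs
    have sa : ContDiffOn ℝ 1 (u₁ s) K := contDiffOn_slice_of_contDiffOn_uncurry hu₁ hsS
    have sb : ContDiffOn ℝ 1 (u₂ s) K := contDiffOn_slice_of_contDiffOn_uncurry hu₂ hsS
    have sP₁ : ContDiffOn ℝ 1 (p₁ s) K := contDiffOn_slice_of_contDiffOn_uncurry hq₁ hsS
    have sP₂ : ContDiffOn ℝ 1 (p₂ s) K := contDiffOn_slice_of_contDiffOn_uncurry hq₂ hsS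
    have sa' : ContinuousOn (timeDerivWithin S u₁ s) K :=
      cu₁'.comp (continuous_const.prodMk continuous_id).continuousOn fun y hy => ⟨hsS, hy⟩
    have sb' : ContinuousOn (timeDerivWithin S u₂ s) K :=
      cu₂'.comp (continuous_const.prodMk continuous_id).continuousOn fun y hy => ⟨hsS, hy⟩
    have hMs : ∀ p ∈ cylBoxOpen L, ‖fderiv ℝ (u₂ s) (cylCoord p)‖ ≤ M := fun p hp => by
      have hxo : cylCoord p ∈ unitCylinder := cylCoord_mem_of_mem_cylBoxOpen hp
      refine (norm_fderiv_slice_le hu₂ one_ne_zero hsS (subset_closure hxo)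
        (closure_unitCylinder_mem_nhds hxo)).trans ?_
      exact hMb (s, p) ⟨hs, mem_cylBox_of_mem_cylBoxOpen hp⟩
    have key := setIntegral_energyFlux_le hL.le sa sb sP₁ sP₂ sa' sb'
      (fun y hy => by simpa using h₁.euler.momentum s hsS y hy)
      (fun y hy => by simpa using h₂.euler.momentum s hsS y hy)
      (h₁.euler.divFree s hsS) (h₂.euler.divFree s hsS) (h₁.euler.slip s hsS) (h₂.euler.slip s hsS)
      (h₁.periodic s hsS).1 (h₂.periodic s hsS).1 (h₁.periodic s hsS).2 (h₂.periodic s hsS).2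
      hMs
    simpa only [hφ, he, hw, hw'] using key
  -- (B4) Grönwall: `exp(-2Ms) e(s)` is nonincreasing on `[0, T']`, and `e 0 = 0`
  set g : ℝ → ℝ := fun s => Real.exp (-(2 * M) * s) * e s with hg
  have hgd : ∀ s ∈ Ioo 0 T', HasDerivAt g
      (Real.exp (-(2 * M) * s) * (-(2 * M) * 1) * e s + Real.exp (-(2 * M) * s) * φ s) s :=
    fun s hs => (((hasDerivAt_id s).const_mul (-(2 * M))).exp).mul (hB2 s hs)
  have hanti : AntitoneOn g (Icc 0 T') := by
    refine antitoneOn_of_deriv_nonpos (convex_Icc 0 T') ?_ ?_ ?_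
    · exact ((Real.continuous_exp.comp (continuous_const.mul continuous_id)).continuousOn).mul hB1
    · rw [interior_Icc]
      exact fun s hs => (hgd s hs).differentiableAt.differentiableWithinAt
    · rw [interior_Icc]
      intro s hs
      rw [(hgd s hs).deriv]
      have h3 := hB3 s (Ioo_subset_Icc_self hs)
      have hexp : 0 < Real.exp (-(2 * M) * s) := Real.exp_pos _
      nlinarith
  have he0 : e 0 = 0 := by
    simp [he, hw, h₁.initial, h₂.initial]
  have htI : t ∈ Icc 0 T' := ⟨ht.1, htT'.le⟩
  have hepos : 0 ≤ e t :=
    setIntegral_nonneg hBmeas fun p hp => mul_nonneg (radius_mem_of_mem_cylBox hp).1 (sq_nonneg _)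
  have het : e t = 0 := by
    have hgt : g t ≤ g 0 := hanti (left_mem_Icc.2 hT'0.le) htI ht.1
    have hg0 : g 0 = 0 := by simp [hg, he0]
    have hexp : 0 < Real.exp (-(2 * M) * t) := Real.exp_pos _
    have hprod : Real.exp (-(2 * M) * t) * e t ≤ Real.exp (-(2 * M) * t) * 0 := by
      rw [mul_zero]; exact hgt.trans_eq hg0
    exact le_antisymm (le_of_mul_le_mul_left hprod hexp) hepos
  -- (B5) the integrand vanishes on the box, hence `w t = 0` on the closed cylinder
  have hint : IntegrableOn (fun p => p 0 * ‖w t (cylCoord p)‖ ^ 2) (cylBox L) :=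
    (cFs t htI).integrableOn_compact isCompact_Icc
  have hnn : 0 ≤ᵐ[volume.restrict (cylBox L)] fun p => p 0 * ‖w t (cylCoord p)‖ ^ 2 :=
    hmemB.mono fun p hp => mul_nonneg (radius_mem_of_mem_cylBox hp).1 (sq_nonneg _)
  have hae := (setIntegral_eq_zero_iff_of_nonneg_ae hnn hint).1 het
  have hzero : EqOn (fun p => p 0 * ‖w t (cylCoord p)‖ ^ 2) 0 (cylBox L) :=
    Measure.eqOn_of_ae_eq hae (cFs t htI) continuousOn_const (cylBox_subset_closure_interior hL)
  have hvan : ∀ p ∈ cylBox L, 0 < p 0 → w t (cylCoord p) = 0 := fun p hp hp0 => by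
    have h := hzero hp
    simp only [Pi.zero_apply, mul_eq_zero, hp0.ne', false_or, pow_eq_zero_iff, ne_eq,
      OfNat.ofNat_ne_zero, not_false_eq_true, norm_eq_zero] at h
    exact h
  have cwt : ContinuousOn (w t) K :=
    (cu₁.comp (continuous_const.prodMk continuous_id).continuousOn fun y hy => ⟨ht, hy⟩).sub
      (cu₂.comp (continuous_const.prodMk continuous_id).continuousOn fun y hy => ⟨ht, hy⟩)
  have hperw : IsAxiallyPeriodic L (w t) := fun y => by
    simp only [hw, (h₁.periodic t ht).1 y, (h₂.periodic t ht).1 y]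
  exact sub_eq_zero.1 (eqOn_zero_closure_of_cylCoord hL cwt hperw hvan x hx)

end Literature.Analysis.FluidPDE
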